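import Literature.MathematicalPhysics.QuantumFieldTheory.Balaban1983to89.B13Lemma1TorusFull

/-!
# `Balaban1983to89.B13Lemma1TorusTower` — T. Bałaban, *Renormalization group approach to lattice gauge field theories.
II. Cluster expansions*, Commun. Math. Phys. **116** (1988) 1–22, doi:10.1007/bf01239022 [Balaban1988RG2Cluster]:
**Lemma 1 (1.33)–(1.36) p. 9 on the two-scale torus with the (1.26) sums taken over the TOWER OF TORI** — the X-index
families of both chains of `B13Lemma1TorusFull.lemma1Printed_twoTorus_full` (X ∈ 𝐃_j, X ∋ □′, j ≤ k) instantiated by the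
localization domains of the scale-j tori `TreeLengthTorus.tsys 4 (N_j)` (the periodic carrier of [Balaban1987RG1] p. 251
at every scale, packaged over j in a Σ-type), whereupon the by-reference input **(1.26)** p. 8 — *"Σ_{X∈𝐃_j, X⊃□′}
exp(−κd_j(X)) ≤ O(1), (1.26) for κ sufficiently large … see [48, 50, 40, 26, 3]"* — is DISCHARGED at every scale and at
both rates κ and δκ by the tree's `TreeLengthTorus.ineq126_torus` (O(1) = K₀(64, 8), threshold κ₀(64, 8) of
`…B12TreeDecay`)

statement-level skeleton of published theorems with citation tags; proofs where landed; nothing here is a claim about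
the Yang–Mills mass gap

PDF held: `paper:balaban1988-cmp116-rg-ii-cluster` (journal page = PDF page + 0); p. 8 (1.26) re-read this session as an
image (`…/1988-cmp116-rg-II-cluster-p008-x2.png`) and from the text layer.

CITATION HEADER / WHAT IS REPRODUCED (cell `pub-ymgap`, Track A node N10 = [B13], prover seat `pub-ymgap-dag-p2`, fifth
module; NEW LEAF over `B13Lemma1TorusFull` (p404321), nothing there modified).  p. 8 [PDF 8], verbatim: *"At first we
consider the sum over X. We take X ∈ 𝐃_j, X ⊂ □̃². This sum can be bounded by two sums, the first is over □′ ∈ π_j,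
□′ ⊂ □̃², the second over X ∈ 𝐃_j such that □′ ⊂ X. For the second sum we have Σ_{X∈𝐃_j, X⊃□′} exp(−κd_j(X)) ≤ O(1),
(1.26) for κ sufficiently large."*; p. 9 [PDF 9]: *"we sum over X containing □′, using the second exponential in (1.32),
and the inequality (1.26) for δκ sufficiently large."*
* `sum_exp_tower_le` — (1.26) for the Σ-packaged tower families: for every scale-indexed cube `q = ⟨j, □′⟩`, the sum
  of `exp(−t·d_j(X))` over the domains X ∋ □′ of the scale-j torus (`(tcubeSys 4 N_j).above □′`, embedded in
  `Σ j, 𝐃_j`) is ≤ K₀(64, 8) once t ≥ κ₀(64, 8) — `TreeLengthTorus.ineq126_torus` BY NAME.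
* `lemma1Printed_twoTorus_tower` — `B13.Lemma1Printed W.toStepData c` for `W : TwoTorusStep 4 L N′` =
  `lemma1Printed_twoTorus_full` with, for BOTH term types, □′ ∈ `Σ j, π_j` (`TPt 4 (N_j)`), X ∈ `Σ j, 𝐃_j`
  (`TDom 4 (N_j)`), the X-families := the scale-j domains containing □′, d_j(X) := `torusTreeLen`, O(1) := K₀(64, 8),
  and the two (1.26) hypotheses REPLACED by the thresholds κ ≥ κ₀(64, 8), δκ ≥ κ₀(64, 8).  What remains
  located-by-reference:
  the per-term analytic inputs (1.24) / (1.30) / analyticity, (1.31)'s X₀-data per term (the inequality itself is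
  `B13Lemma1TorusFull.ineq131_torus` when X₀ = the blocks met by X), the cube COUNTS of [I]'s block geometry («8·12³»,
  «(6L)⁴L^jη», the □′-sum O₂), thresholds, R8, R9, the constants — and nothing about tree lengths.
HONEST FRAMING: a count-neutral Track-A side landing (YM-PLAN §1); NOT a discharge of node N10 (B13 group FREE at
NODE 00 Stages 1–2); one finite T⁴ programme at fixed ε; nothing continuum / OS / mass-gap / Clay.
-/

noncomputable section

namespace Literature.MathematicalPhysics.QuantumFieldTheory.Balaban1983to89.B13Lemma1TorusTower

open Literature.MathematicalPhysics.QuantumFieldTheory.Balaban1983to89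
open Literature.MathematicalPhysics.QuantumFieldTheory.Balaban1983to89.TreeLengthTorus
open Literature.MathematicalPhysics.QuantumFieldTheory.Balaban1983to89.B12TreeDecay (kappa₀ K₀ K₀_pos)
open Literature.MathematicalPhysics.QuantumFieldTheory.Balaban1983to89.B13Lemma3Torus (TwoTorusStep)
open Literature.MathematicalPhysics.QuantumFieldTheory.Balaban1983to89.B13Lemma1TorusFull (lemma1Printed_twoTorus_full)

/-! ## §1. (1.26) over the tower of tori -/

/-- **(1.26) p. 8 at every scale of the TOWER OF TORI** (*"Σ_{X∈𝐃_j, X⊃□′} exp(−κd_j(X)) ≤ O(1), (1.26) for κ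
sufficiently large"*): for a family of tori with `N_j` cubes of π_j per direction and a scale-indexed cube
`q = ⟨j, □′⟩`,
the sum of `exp(−t·d_j(X))` over the scale-j torus localization domains X ∋ □′ (embedded in `Σ j, 𝐃_j`) is at most
K₀(64, 8) for every t ≥ κ₀(64, 8) — `TreeLengthTorus.ineq126_torus` (← `B12TreeDecay.ineq126_of_volumeLeaf`) BY NAME.
[cite: Balaban1988RG2Cluster, (1.26) p.8] -/
theorem sum_exp_tower_le (Nc : ℕ → ℕ) [∀ j, NeZero (Nc j)] {t : ℝ} (ht : kappa₀ 64 8 ≤ t)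
    (q : Σ j, TPt 4 (Nc j)) :
    ∑ x ∈ ((tcubeSys 4 (Nc q.1)).above q.2).map (Function.Embedding.sigmaMk (β := fun i => TDom 4 (Nc i)) q.1),
      Real.exp (-(t * torusTreeLen x.2.1)) ≤ K₀ 64 8 := by
  have hκ : kappa₀ (4 * 2 ^ 4) (2 * 4) ≤ t := by norm_num; exact ht
  have h := ineq126_torus 4 (Nc q.1) hκ q.2
  have hK : K₀ (4 * 2 ^ 4) (2 * 4) = K₀ 64 8 := by norm_num
  rw [hK] at h
  rw [Finset.sum_map]
  refine le_of_eq_of_le (Finset.sum_congr rfl fun X _ => ?_) h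
  rw [tsys_dj, neg_mul]
  rfl

/-! ## §2. Lemma 1 on the two-scale torus, (1.26) taken over the tower -/

section Torus

variable {L N' : ℕ} [NeZero L] [NeZero N']

/-- **LEMMA 1 (1.33)–(1.36) p. 9 ON THE TWO-SCALE TORUS, X-SUMS OVER THE TOWER OF TORI.**  `B13.Lemma1Printed
W.toStepData c` for `W : TwoTorusStep 4 L N′`: `B13Lemma1TorusFull.lemma1Printed_twoTorus_full` with, for both term
types, the cubes □′ of π_j as `Σ j, TPt 4 (N_j)`, the domains X ∈ 𝐃_j, X ∋ □′ as the scale-j torus localization domains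
containing □′ (`(tcubeSys 4 N_j).above □′` inside `Σ j, TDom 4 (N_j)`), d_j(X) := `torusTreeLen`, O(1) := K₀(64, 8);
the two (1.26) inputs are now the theorems `sum_exp_tower_le` at the rates κ (`hκ126`) and δκ (`hκ126'`).  Every other
hypothesis is that of `lemma1Printed_twoTorus_full` (per-term (1.24) / (1.30) / (1.31)-data / analyticity by reference;
counts «8·12³», «(6L)⁴L^jη», O₂; torus data of □₀, X₀, □; thresholds; R8, R9; constants with
P₁ = K·K₀·2(6L)⁴·e·e^{⅛κ₁d₀}, P₂ = 2·64K′·K₀·O₂). [cite: Balaban1988RG2Cluster, Lemma 1 pp.7–9] -/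
theorem lemma1Printed_twoTorus_tower (W : TwoTorusStep 4 L N') (c : B13.Consts) (Nc : ℕ → ℕ) [∀ j, NeZero (Nc j)]
    {α C α' : Type*}
    -- the (I.3.34)/(I.3.21)-type index data
    (S0 : TDom 4 (L * N') → Finset α) (blk : TDom 4 (L * N') → α → Finset (TPt 4 (L * N')))
    (F : TDom 4 (L * N') → α → Finset C) (k : ℕ) (Sq : TDom 4 (L * N') → ℕ → Finset (Σ j, TPt 4 (Nc j)))
    (T : TDom 4 (L * N') → α → Finset C → ℕ → (Σ j, TPt 4 (Nc j)) → (Σ j, TDom 4 (Nc j)) → W.Φ → ℂ)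
    (N : TDom 4 (L * N') → α → Finset C → ℝ)
    -- the (I.3.7)-type index data
    (Sc : TDom 4 (L * N') → Finset α') (Sq' : TDom 4 (L * N') → α' → ℕ → Finset (Σ j, TPt 4 (Nc j)))
    (T' : TDom 4 (L * N') → α' → ℕ → (Σ j, TPt 4 (Nc j)) → (Σ j, TDom 4 (Nc j)) → W.Φ → ℂ)
    (dist : TDom 4 (L * N') → α' → ℕ → (Σ j, TPt 4 (Nc j)) → ℝ)
    (X0 : TDom 4 (L * N') → α' → ℕ → (Σ j, TPt 4 (Nc j)) → (Σ j, TDom 4 (Nc j)) → Finset (TPt 4 (L * N')))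
    (n : TDom 4 (L * N') → α' → ℕ → (Σ j, TPt 4 (Nc j)) → (Σ j, TDom 4 (Nc j)) → ℕ) {K d0 K' O₂ : ℝ}
    (h133 : ∀ Y, W.Vp Y = (∑ a ∈ S0 Y, ∑ X ∈ (F Y a).powerset, ∑ j ∈ Finset.range (k + 1), ∑ q ∈ Sq Y j,
      ∑ x ∈ ((tcubeSys 4 (Nc q.1)).above q.2).map (Function.Embedding.sigmaMk (β := fun i => TDom 4 (Nc i)) q.1),
        T Y a X j q x) +
      (∑ a ∈ Sc Y, ∑ j ∈ Finset.range (k + 1), ∑ q ∈ Sq' Y a j,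
        ∑ x ∈ ((tcubeSys 4 (Nc q.1)).above q.2).map (Function.Embedding.sigmaMk (β := fun i => TDom 4 (Nc i)) q.1),
          T' Y a j q x))
    (hAdd : ∀ (s : Set W.Φ) (f g : W.Φ → ℂ), W.Analytic f s → W.Analytic g s → W.Analytic (f + g) s)
    (hZero : ∀ s : Set W.Φ, W.Analytic 0 s)
    (hAnT : ∀ Y, ∀ a ∈ S0 Y, ∀ X ∈ (F Y a).powerset, ∀ j ∈ Finset.range (k + 1), ∀ q ∈ Sq Y j,
      ∀ x ∈ ((tcubeSys 4 (Nc q.1)).above q.2).map (Function.Embedding.sigmaMk (β := fun i => TDom 4 (Nc i)) q.1),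
        W.Analytic (T Y a X j q x) (W.sp1 Y))
    (hAnT' : ∀ Y, ∀ a ∈ Sc Y, ∀ j ∈ Finset.range (k + 1), ∀ q ∈ Sq' Y a j,
      ∀ x ∈ ((tcubeSys 4 (Nc q.1)).above q.2).map (Function.Embedding.sigmaMk (β := fun i => TDom 4 (Nc i)) q.1),
        W.Analytic (T' Y a j q x) (W.sp1 Y))
    (hK : 0 ≤ K) (hd0 : 0 ≤ d0) (hK' : 0 ≤ K') (hO₂ : 0 ≤ O₂)
    (hL : 2 ≤ (c.L : ℝ)) (hκ : 0 ≤ c.κ) (hδ1 : c.δ < 1) (hδκ : 1 ≤ c.δ * c.κ)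
    (hκ126 : kappa₀ 64 8 ≤ c.κ) (hκ126' : kappa₀ 64 8 ≤ c.δ * c.κ)
    (hκ₁ : 1 + 2 * Real.log (8 * 12 ^ 3) ≤ c.κ₁) (hκ₁' : 2 + 16 * Real.log 128 ≤ c.κ₁)
    (hδ₀M : 2 * Real.exp (-1) ≤ c.δ₀ * c.M) (hR8 : (1 - c.δ) * c.κ ≤ (1 / 4) * (c.κ₁ - 1))
    (hR9 : (1 - 2 * c.δ) * c.κ ≤ (1 / 16) * c.κ₁)
    (h124 : ∀ Y φ, φ ∈ W.sp1 Y → ∀ a ∈ S0 Y, ∀ X ∈ (F Y a).powerset, ∀ j ∈ Finset.range (k + 1), ∀ q ∈ Sq Y j,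
      ∀ x ∈ ((tcubeSys 4 (Nc q.1)).above q.2).map (Function.Embedding.sigmaMk (β := fun i => TDom 4 (Nc i)) q.1),
        ‖T Y a X j q x φ‖ ≤ K * ((c.L : ℝ) ^ j * ((c.L : ℝ) ^ k)⁻¹) ^ 5 *
          Real.exp (-(c.κ₁ - 1) * N Y a X) * Real.exp (-(c.κ * torusTreeLen x.2.1)))
    (hblk : ∀ Y, ∀ a ∈ S0 Y, blk Y a ⊆ Y.1 ∧ IsTDom (blk Y a) ∧ torusTreeLen (blk Y a) ≤ d0 ∧
      (5 : ℝ) * 2 ^ 4 ≤ (blk Y a).card)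
    (hNblk : ∀ Y, ∀ a ∈ S0 Y, ∀ X ∈ (F Y a).powerset, ((Y.1 \ blk Y a).card : ℝ) ≤ N Y a X)
    (hN : ∀ Y a, ∀ X ∈ (F Y a).powerset, (X.card : ℝ) ≤ N Y a X)
    (hF : ∀ Y a, ((F Y a).card : ℝ) ≤ 8 * 12 ^ 3)
    (hS0 : ∀ Y, (S0 Y).card ≤ Y.1.card)
    (hq : ∀ Y, ∀ j ∈ Finset.range (k + 1),
      ((Sq Y j).card : ℝ) * ((c.L : ℝ) ^ j * ((c.L : ℝ) ^ k)⁻¹) ^ 5 ≤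
        (6 * (c.L : ℝ)) ^ 4 * ((c.L : ℝ) ^ j * ((c.L : ℝ) ^ k)⁻¹))
    (h130 : ∀ Y φ, φ ∈ W.sp1 Y → ∀ a ∈ Sc Y, ∀ j ∈ Finset.range (k + 1), ∀ q ∈ Sq' Y a j,
      ∀ x ∈ ((tcubeSys 4 (Nc q.1)).above q.2).map (Function.Embedding.sigmaMk (β := fun i => TDom 4 (Nc i)) q.1),
        ‖T' Y a j q x φ‖ ≤ K' * Real.exp (-(1 / 2) * (c.δ₀ * c.M) * ((c.L : ℝ) ^ j * ((c.L : ℝ) ^ k)⁻¹)⁻¹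
            - (1 / 2) * c.δ₀ * dist Y a j q) *
          Real.exp (-(c.κ₁ - 1) * (n Y a j q x : ℝ)) * Real.exp (-(c.κ * torusTreeLen x.2.1)))
    (h131 : ∀ Y, ∀ a ∈ Sc Y, ∀ j ∈ Finset.range (k + 1), ∀ q ∈ Sq' Y a j,
      ∀ x ∈ ((tcubeSys 4 (Nc q.1)).above q.2).map (Function.Embedding.sigmaMk (β := fun i => TDom 4 (Nc i)) q.1),
        torusTreeLen (X0 Y a j q x) ≤ ((c.L : ℝ) ^ j * ((c.L : ℝ) ^ k)⁻¹) * torusTreeLen x.2.1)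
    (hX0 : ∀ Y, ∀ a ∈ Sc Y, ∀ j ∈ Finset.range (k + 1), ∀ q ∈ Sq' Y a j,
      ∀ x ∈ ((tcubeSys 4 (Nc q.1)).above q.2).map (Function.Embedding.sigmaMk (β := fun i => TDom 4 (Nc i)) q.1),
        X0 Y a j q x ⊆ Y.1 ∧ IsTDom (X0 Y a j q x))
    (hn : ∀ Y, ∀ a ∈ Sc Y, ∀ j ∈ Finset.range (k + 1), ∀ q ∈ Sq' Y a j,
      ∀ x ∈ ((tcubeSys 4 (Nc q.1)).above q.2).map (Function.Embedding.sigmaMk (β := fun i => TDom 4 (Nc i)) q.1),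
        (Y.1 \ X0 Y a j q x).card ≤ n Y a j q x)
    (hq' : ∀ Y, ∀ a ∈ Sc Y, ∀ j ∈ Finset.range (k + 1),
      ∑ q ∈ Sq' Y a j, Real.exp (-((1 / 2) * c.δ₀ * dist Y a j q)) ≤ O₂)
    (hSc : ∀ Y, (Sc Y).card ≤ Y.1.card)
    (hC : K * K₀ 64 8 * (2 * (6 * (c.L : ℝ)) ^ 4) * Real.exp 1 * Real.exp ((1 / 8) * c.κ₁ * d0) +
        2 * (64 * K') * K₀ 64 8 * O₂ ≤
      c.E₀ * c.ε₁ * c.C₁ * c.M ^ c.q * Real.exp (c.C₂ * c.κ₁)) :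
    B13.Lemma1Printed W.toStepData c := by
  have hO1 : (0 : ℝ) ≤ K₀ 64 8 := (K₀_pos _ _).le
  -- (1.26) at the rate κ for the (I.3.34)-type chain and at the rate δκ for the (I.3.7)-type chain: tower theorems
  have h126 : ∀ Y : TDom 4 (L * N'), ∀ j ∈ Finset.range (k + 1), ∀ q ∈ Sq Y j,
      ∑ x ∈ ((tcubeSys 4 (Nc q.1)).above q.2).map (Function.Embedding.sigmaMk (β := fun i => TDom 4 (Nc i)) q.1),
        Real.exp (-(c.κ * torusTreeLen x.2.1)) ≤ K₀ 64 8 :=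
    fun _ _ _ q _ => sum_exp_tower_le Nc hκ126 q
  have h126' : ∀ Y : TDom 4 (L * N'), ∀ a ∈ Sc Y, ∀ j ∈ Finset.range (k + 1), ∀ q ∈ Sq' Y a j,
      ∑ x ∈ ((tcubeSys 4 (Nc q.1)).above q.2).map (Function.Embedding.sigmaMk (β := fun i => TDom 4 (Nc i)) q.1),
        Real.exp (-(c.δ * c.κ * torusTreeLen x.2.1)) ≤ K₀ 64 8 :=
    fun _ _ _ _ _ q _ => sum_exp_tower_le Nc hκ126' q
  exact lemma1Printed_twoTorus_full W c S0 blk F k Sq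
    (fun _ _ q => ((tcubeSys 4 (Nc q.1)).above q.2).map
      (Function.Embedding.sigmaMk (β := fun i => TDom 4 (Nc i)) q.1)) T
    (fun _ _ _ x => torusTreeLen x.2.1) N Sc Sq'
    (fun _ _ _ q => ((tcubeSys 4 (Nc q.1)).above q.2).map
      (Function.Embedding.sigmaMk (β := fun i => TDom 4 (Nc i)) q.1)) T' dist
    (fun _ _ _ _ x => torusTreeLen x.2.1) X0 n h133 hAdd hZero hAnT hAnT' hK hO1 hd0 hK' hO1 hO₂ hL hκ hδ1 hδκ hκ₁ hκ₁'
    hδ₀M hR8 hR9 h124 hblk hNblk hN hF hS0 h126 hq h130 (fun _ _ _ _ x => torusTreeLen_nonneg x.2.1) h131 hX0 hn h126'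
    hq' hSc hC

end Torus

end Literature.MathematicalPhysics.QuantumFieldTheory.Balaban1983to89.B13Lemma1TorusTower
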